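import Literature.AlgebraicGeometry.Resolution.HironakaDirectrixQuadratic
import Literature.AlgebraicGeometry.Resolution.HironakaDirectrixPolar
import Literature.AlgebraicGeometry.Resolution.HironakaDirectrixVars
import Summits.ResolutionOfSingularities.ResolutionOfSingularities.Theorems.HilbertSamuelEliminationSigmaMaxModificationsCorridor3HypersurfacePoints
import HarnessLib

/-!
# [OURS · L1 W3.2 · kill test K3.2′] Campaign W3.2: the directrix dimension `e` SEPARATES the
# K3.2 pairs that the Hilbert–Samuel function does not (variant V-c «(H_X, e_X)»)

[OURS · L1 W3.2] Kernel layer of kill test K3.2′ (cell res-hironaka, rung L, slot W3.2 «canonical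
strata instead of Ě», variant (V-c) = «Hilbert–Samuel function refined by the directrix dimension»,
director-resolution ruling 2026-08-26T20:56:10Z; pre-registration `L/res-L1-k32/PREREG-K3.2prime.md`).
NOT a statement of the manuscript [claim: Hironaka2017, status: under-review]; replaces nothing in it.

Kill test K3.2 (this campaign, `MarkedTransferCampaignW32WQTopLocus`, `…W31QuinticEdgeData`) exhibited
two pairs of closed points with EQUAL Hilbert–Samuel function and DIFFERENT Hironaka `Inv`:
W1 = `y² − x²z² + x⁵` (char `≠ 2`): `O = (0,0,0)` vs `ξ_c = (0,0,c)`, `c ≠ 0`, tangent cones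
`ȳ²` and `ȳ² − c²x̄²`; W2 = the W-Q normal form `fW` on `𝔸⁵` (char `2`): `0` vs `P = (0,0,1,1,0)`,
tangent cones `x̄²` and `x̄² + v̄² + ȳw̄`. The secondary invariant of Cossart–Jannsen–Saito is the
directrix dimension `e_x = n − dim 𝒯(in_x f) = n − τ(in_x f)` (CJS Def. 2.8 / 2.18; Hironaka's `τ` of
the initial form, tree `hironakaTau`, `invarianceSpace`). We PROVE, over the tree's directrix API:

* `hironakaTau_ySq` — `τ(ȳ²) = 1` in `k[x̄,ȳ,z̄]`, `2 ≠ 0` (so `e_O = 2`);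
* `hironakaTau_ySq_sub_sq` — `τ(ȳ² − c²x̄²) = 2` for `c ≠ 0`, `2 ≠ 0` (so `e_{ξ_c} = 1`);
* `hironakaTau_xSq` — `τ(x̄²) = 1` in `k[x̄,ȳ,z̄,w̄,v̄]`, every characteristic (so `e_0 = 4`);
* `invarianceSpace_wqP_iff`, `hironakaTau_wqP` — in characteristic `2`,
  `𝕎(x̄² + v̄² + ȳw̄) = {w | w_y = w_w = 0, w_x = w_v}` and `τ = 3` (so `e_P = 2`);
* `e_separates_W1`, `e_separates_W2` — the differences `3 − τ`: `2 ≠ 1` and `4 ≠ 2`;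
* `hsFun_eq_of_hypersurface_presentations` — the Hilbert–Samuel half over the tree's
  `Scheme.hsFun`: two hypersurface points of the same multiplicity (stalks `≅ R/(g)`, `R` regular
  local of dimension `≤ N + 1`, `g` of order exactly `m ≥ 1`) have the same `H^N` (Bennett; the
  chain w42 toolkit `SigmaMaxModificationsCorridor3.Helpers.hsFun_eq_hypersurfaceHFe_of_stalk_ringEquiv`).

So the function `(H_X, e_X)` separates both K3.2 pairs, with the `Inv`-maximal point `O` of W1 in
the larger-`e` (worse, CJS Thm. 3.10/3.14) class. This is the kernel content of verdict K3.2′(V-c).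

## Sources

* V. Cossart, U. Jannsen, S. Saito, LNM 2270 (2020), Lemma 2.7, Def. 2.8, Def. 2.18, Def. 2.28,
  Thm. 3.10, Thm. 3.14. [CossartJannsenSaito2020]
* V. Cossart, O. Piltant, J. Algebra 320 (2008), proof of Prop. 4.2 (`τ`, `𝕎`). [CossartPiltant2008]
-/

set_option linter.dupNamespace false -- mandated namespace of this single-conjunct summit

noncomputable section

open MvPolynomial
open Literature.AlgebraicGeometry.Resolution

namespace Summit.ResolutionOfSingularities.ResolutionOfSingularities.Theorems.CampaignW32.K32Prime

universe u v

variable (k : Type u) [Field k]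

/-! ## W1 (`char k ≠ 2`): `τ(ȳ²) = 1`, `τ(ȳ² − c²x̄²) = 2` in `k[x̄, ȳ, z̄]` (`0 ↦ x̄, 1 ↦ ȳ, 2 ↦ z̄`) -/

/-- `∂_ȳ(ȳ²) = 2ȳ`. [cite: CossartJannsenSaito2020, Def. 2.8] -/
theorem pderiv_one_ySq :
    pderiv (1 : Fin 3) (X 1 ^ 2 : MvPolynomial (Fin 3) k) = C 2 * X 1 := by
  rw [map_ofNat C 2]
  simp; try ring

/-- **`τ(ȳ²) = 1`** (`2 ≠ 0`): the polar lower bound (`2ȳ ≠ 0`) and the bound by the number of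
occurring variables. So `e_O(X₁) = 3 − 1 = 2` for `X₁ = V(y² − x²z² + x⁵)`.
[cite: CossartJannsenSaito2020, Def. 2.8, Def. 2.18] [cite: CossartPiltant2008, proof of Prop. 4.2] -/
theorem hironakaTau_ySq (h2 : (2 : k) ≠ 0) :
    hironakaTau k ({X 1 ^ 2} : Set (MvPolynomial (Fin 3) k)) = 1 := by
  apply le_antisymm
  · refine le_trans (hironakaTau_le_card_vars k _) ?_
    exact le_trans (Finset.card_le_card (vars_pow _ _)) (by rw [vars_X]; simp)
  · have hli : LinearIndependent k fun _ : Fin 1 =>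
        pderiv (1 : Fin 3) (X 1 ^ 2 : MvPolynomial (Fin 3) k) := by
      rw [pderiv_one_ySq]
      refine linearIndependent_unique_iff.mpr ?_
      exact mul_ne_zero (by rw [Ne, C_eq_zero]; exact h2) (X_ne_zero _)
    have h := card_le_hironakaTau_of_linearIndependent_pderiv k
      (X 1 ^ 2 : MvPolynomial (Fin 3) k) (fun _ : Fin 1 => (1 : Fin 3)) hli
    simpa using h

/-- `∂_x̄(ȳ² − c²x̄²) = −2c²·x̄`, `∂_ȳ(ȳ² − c²x̄²) = 2ȳ`. [cite: CossartJannsenSaito2020, Def. 2.8] -/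
theorem pderiv_ySq_sub_sq (c : k) :
    pderiv (0 : Fin 3) (X 1 ^ 2 - C (c ^ 2) * X 0 ^ 2 : MvPolynomial (Fin 3) k) =
        C (-(2 * c ^ 2)) * X 0 ∧
      pderiv (1 : Fin 3) (X 1 ^ 2 - C (c ^ 2) * X 0 ^ 2 : MvPolynomial (Fin 3) k) = C 2 * X 1 := by
  have hC : (C 2 : MvPolynomial (Fin 3) k) = 2 := map_ofNat C 2
  constructor
  · simp only [map_neg, map_mul, hC, map_pow]
    simp; try ring
  · rw [hC]
    simp; try ring

/-- Non-zero scalar multiples of two distinct variables are linearly independent. [folklore] -/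
theorem linearIndependent_C_mul_X_pair {a b : k} (ha : a ≠ 0) (hb : b ≠ 0) :
    LinearIndependent k ![(C a * X 0 : MvPolynomial (Fin 3) k), C b * X 1] := by
  have hX : LinearIndependent k fun j : Fin 2 =>
      (X (Fin.castLE (by norm_num : 2 ≤ 3) j) : MvPolynomial (Fin 3) k) :=
    (linearIndependent_X (Fin 3) k).comp _ (Fin.castLE_injective _)
  have h := hX.units_smul ![Units.mk0 a ha, Units.mk0 b hb]
  convert h using 1
  funext j
  fin_cases j <;> simp [Units.smul_def, smul_eq_C_mul]

/-- The two partials `−2c²x̄`, `2ȳ` of `ȳ² − c²x̄²` are linearly independent (`c ≠ 0`, `2 ≠ 0`).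
[cite: CossartJannsenSaito2020, Def. 2.8] -/
theorem linearIndependent_pderiv_ySq_sub_sq (h2 : (2 : k) ≠ 0) {c : k} (hc : c ≠ 0) :
    LinearIndependent k fun j : Fin 2 =>
      pderiv (Fin.castLE (by norm_num : 2 ≤ 3) j)
        (X 1 ^ 2 - C (c ^ 2) * X 0 ^ 2 : MvPolynomial (Fin 3) k) := by
  obtain ⟨h0, h1⟩ := pderiv_ySq_sub_sq k c
  have hfam : (fun j : Fin 2 => pderiv (Fin.castLE (by norm_num : 2 ≤ 3) j)
      (X 1 ^ 2 - C (c ^ 2) * X 0 ^ 2 : MvPolynomial (Fin 3) k)) =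
        ![C (-(2 * c ^ 2)) * X 0, C 2 * X 1] := by
    funext j
    fin_cases j
    · exact h0
    · exact h1
  rw [hfam]
  have hc2 : (-(2 * c ^ 2) : k) ≠ 0 := neg_ne_zero.mpr (mul_ne_zero h2 (pow_ne_zero 2 hc))
  exact linearIndependent_C_mul_X_pair k hc2 h2

/-- **`τ(ȳ² − c²x̄²) = 2`** (`c ≠ 0`, `2 ≠ 0`): two independent partials, two occurring variables.
So `e_{ξ_c}(X₁) = 3 − 2 = 1` at every point `ξ_c = (0,0,c)`, `c ≠ 0`, of the top Hilbert–Samuel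
locus of `X₁ = V(y² − x²z² + x⁵)`. [cite: CossartJannsenSaito2020, Def. 2.8, Def. 2.18]
[cite: CossartPiltant2008, proof of Prop. 4.2] -/
theorem hironakaTau_ySq_sub_sq (h2 : (2 : k) ≠ 0) {c : k} (hc : c ≠ 0) :
    hironakaTau k ({X 1 ^ 2 - C (c ^ 2) * X 0 ^ 2} : Set (MvPolynomial (Fin 3) k)) = 2 := by
  classical
  apply le_antisymm
  · refine le_trans (hironakaTau_le_card_vars k _) ?_
    refine le_trans (Finset.card_le_card (vars_sub_subset _)) ?_
    refine le_trans (Finset.card_union_le _ _) ?_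
    have h1 : (X 1 ^ 2 : MvPolynomial (Fin 3) k).vars.card ≤ 1 :=
      le_trans (Finset.card_le_card (vars_pow _ _)) (by rw [vars_X]; simp)
    have h0 : (C (c ^ 2) * X 0 ^ 2 : MvPolynomial (Fin 3) k).vars.card ≤ 1 := by
      refine le_trans (Finset.card_le_card (vars_mul _ _)) ?_
      rw [vars_C, Finset.empty_union]
      exact le_trans (Finset.card_le_card (vars_pow _ _)) (by rw [vars_X]; simp)
    omega
  · have h := card_le_hironakaTau_of_linearIndependent_pderiv k
      (X 1 ^ 2 - C (c ^ 2) * X 0 ^ 2 : MvPolynomial (Fin 3) k) _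
      (linearIndependent_pderiv_ySq_sub_sq k h2 hc)
    simpa using h

/-- **V-c separates the W1 pair**: `e_O = 3 − τ(ȳ²) = 2 ≠ 1 = 3 − τ(ȳ² − c²x̄²) = e_{ξ_c}`, with the
`Inv`-maximal point `O` (K3.1/K3.2) in the LARGER-`e` class (CJS: `e` can only drop at near points).
[cite: CossartJannsenSaito2020, Def. 2.18, Thm. 3.10] -/
theorem e_separates_W1 (h2 : (2 : k) ≠ 0) {c : k} (hc : c ≠ 0) :
    3 - hironakaTau k ({X 1 ^ 2} : Set (MvPolynomial (Fin 3) k)) = 2 ∧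
      3 - hironakaTau k ({X 1 ^ 2 - C (c ^ 2) * X 0 ^ 2} : Set (MvPolynomial (Fin 3) k)) = 1 ∧
      3 - hironakaTau k ({X 1 ^ 2 - C (c ^ 2) * X 0 ^ 2} : Set (MvPolynomial (Fin 3) k)) <
        3 - hironakaTau k ({X 1 ^ 2} : Set (MvPolynomial (Fin 3) k)) := by
  rw [hironakaTau_ySq k h2, hironakaTau_ySq_sub_sq k h2 hc]
  norm_num

/-! ## W2: `τ(x̄²) = 1` (every characteristic) and `τ(x̄² + v̄² + ȳw̄) = 3` (`char k = 2`) in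
`k[x̄, ȳ, z̄, w̄, v̄]` (`0 ↦ x̄, 1 ↦ ȳ, 2 ↦ z̄, 3 ↦ w̄, 4 ↦ v̄`) -/

/-- **`τ(x̄²) = 1` in every characteristic**: one occurring variable, and the coordinate vector
`e_x̄` is NOT in `𝕎(x̄²)` since `x̄²(e_x̄) = 1 ≠ 0` (the quadratic membership criterion — in
characteristic `2` the polar bound is empty, `∂x̄² = 0`). So `e_0(X₂) = 5 − 1 = 4` at the origin of
the W-Q fourfold. [cite: CossartJannsenSaito2020, Def. 2.8, Def. 2.18]
[cite: CossartPiltant2008, proof of Prop. 4.2] -/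
theorem hironakaTau_xSq :
    hironakaTau k ({X 0 ^ 2} : Set (MvPolynomial (Fin 5) k)) = 1 := by
  apply le_antisymm
  · refine le_trans (hironakaTau_le_card_vars k _) ?_
    exact le_trans (Finset.card_le_card (vars_pow _ _)) (by rw [vars_X]; simp)
  · -- `𝕎 ≠ ⊤` since `e_0 ∉ 𝕎`
    have hF : (X 0 ^ 2 : MvPolynomial (Fin 5) k).IsHomogeneous 2 := (isHomogeneous_X k 0).pow 2
    have hnot : (Pi.single 0 1 : Fin 5 → k) ∉
        invarianceSpace k ({X 0 ^ 2} : Set (MvPolynomial (Fin 5) k)) := by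
      rw [mem_invarianceSpace_iff_of_isHomogeneous_two k hF]
      rintro ⟨-, h⟩
      simp at h
    have hne : invarianceSpace k ({X 0 ^ 2} : Set (MvPolynomial (Fin 5) k)) ≠ ⊤ :=
      fun htop => hnot (htop ▸ Submodule.mem_top)
    have hlt : Module.finrank k (invarianceSpace k ({X 0 ^ 2} : Set (MvPolynomial (Fin 5) k))) <
        Module.finrank k (Fin 5 → k) := Submodule.finrank_lt hne
    rw [Module.finrank_fin_fun] at hlt
    have h := hironakaTau_add_finrank_invarianceSpace k ({X 0 ^ 2} : Set (MvPolynomial (Fin 5) k))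
    omega

/-- The polar `D_w` of `x̄² + v̄² + ȳw̄` in characteristic `2` is `w_ȳ·w̄ + w_w̄·ȳ`.
[cite: CossartPiltant2008, proof of Prop. 4.2] -/
theorem polar_wqP (h2 : (2 : k) = 0) (w : Fin 5 → k) :
    ∑ l, C (w l) * pderiv l (X 0 ^ 2 + X 4 ^ 2 + X 1 * X 3 : MvPolynomial (Fin 5) k) =
      C (w 1) * X 3 + C (w 3) * X 1 := by
  have h2' : (2 : MvPolynomial (Fin 5) k) = 0 := by rw [← map_ofNat C 2, h2, map_zero]
  simp only [map_add, Derivation.leibniz_pow, Derivation.leibniz, pderiv_X, smul_eq_mul,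
    nsmul_eq_mul, Nat.cast_ofNat, h2', zero_mul, zero_add, mul_add, Finset.sum_add_distrib]
  simp [Pi.single_apply]
  ring

/-- **`𝕎(x̄² + v̄² + ȳw̄)` in characteristic `2`**: `w ∈ 𝕎 ↔ w_ȳ = 0 ∧ w_w̄ = 0 ∧ w_x̄ = w_v̄`
(polar condition `w_ȳ w̄ + w_w̄ ȳ = 0`, value condition `w_x̄² + w_v̄² + w_ȳw_w̄ = (w_x̄ + w_v̄)² = 0`).
[cite: CossartJannsenSaito2020, Lemma 2.7, Def. 2.8] [cite: CossartPiltant2008, proof of Prop. 4.2] -/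
theorem invarianceSpace_wqP_iff (h2 : (2 : k) = 0) (w : Fin 5 → k) :
    w ∈ invarianceSpace k ({X 0 ^ 2 + X 4 ^ 2 + X 1 * X 3} : Set (MvPolynomial (Fin 5) k)) ↔
      (w 1 = 0 ∧ w 3 = 0 ∧ w 0 = w 4) := by
  classical
  have hF : (X 0 ^ 2 + X 4 ^ 2 + X 1 * X 3 : MvPolynomial (Fin 5) k).IsHomogeneous 2 :=
    (((isHomogeneous_X k 0).pow 2).add ((isHomogeneous_X k 4).pow 2)).add
      ((isHomogeneous_X k 1).mul (isHomogeneous_X k 3))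
  rw [mem_invarianceSpace_iff_of_isHomogeneous_two k hF, polar_wqP k h2]
  -- characteristic 2: `a² + b² = (a + b)²` and `-1 = 1`
  have hsq : ∀ a b : k, a ^ 2 + b ^ 2 = (a + b) ^ 2 := fun a b => by
    have : (2 : k) * (a * b) = 0 := by rw [h2, zero_mul]
    linear_combination -this
  have hneg : ∀ a b : k, a + b = 0 ↔ a = b := fun a b => by
    constructor
    · intro h
      have : a = -b := eq_neg_of_add_eq_zero_left h
      rw [this]
      have h1 : (-1 : k) = 1 := by
        have : (2 : k) = 1 + 1 := by norm_num
        linear_combination -h2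
      linear_combination b * h1
    · rintro rfl
      linear_combination a * h2
  constructor
  · rintro ⟨hpol, hev⟩
    have h3 := congrArg (coeff (Finsupp.single 3 1)) hpol
    have h1 := congrArg (coeff (Finsupp.single 1 1)) hpol
    simp [coeff_X, Finsupp.single_eq_single_iff] at h3 h1
    refine ⟨h3, h1, ?_⟩
    simp [h3, h1] at hev
    rw [hsq] at hev
    exact (hneg _ _).mp (pow_eq_zero_iff (n := 2) (by norm_num) |>.mp hev)
  · rintro ⟨h1, h3, h04⟩
    refine ⟨by simp [h1, h3], ?_⟩
    simp [h1, h3, h04, hsq]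
    exact (hneg _ _).mpr rfl

/-- **`τ(x̄² + v̄² + ȳw̄) = 3` in characteristic `2`** (`dim 𝕎 = 2`). So `e_P(X₂) = 5 − 3 = 2` at
`P = (0,0,1,1,0)` (and along `Γ₂ ∖ 0`) on the W-Q fourfold. [cite: CossartJannsenSaito2020, Def. 2.8,
Def. 2.18] [cite: CossartPiltant2008, proof of Prop. 4.2] -/
theorem hironakaTau_wqP (h2 : (2 : k) = 0) :
    hironakaTau k ({X 0 ^ 2 + X 4 ^ 2 + X 1 * X 3} : Set (MvPolynomial (Fin 5) k)) = 3 := by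
  have hW : Module.finrank k
      (invarianceSpace k ({X 0 ^ 2 + X 4 ^ 2 + X 1 * X 3} : Set (MvPolynomial (Fin 5) k))) = 2 := by
    -- `𝕎 ≃ k²`: free coordinates `w_x̄ = w_v̄` and `w_z̄`
    let E : invarianceSpace k ({X 0 ^ 2 + X 4 ^ 2 + X 1 * X 3} : Set (MvPolynomial (Fin 5) k)) ≃ₗ[k]
        (Fin 2 → k) :=
      { toFun := fun w => ![w.1 0, w.1 2]
        map_add' := fun w w' => by ext j; fin_cases j <;> simp
        map_smul' := fun a w => by ext j; fin_cases j <;> simp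
        invFun := fun a => ⟨![a 0, 0, a 1, 0, a 0], (invarianceSpace_wqP_iff k h2 _).mpr (by simp)⟩
        left_inv := fun w => by
          obtain ⟨w, hw⟩ := w
          obtain ⟨h1, h3, h04⟩ := (invarianceSpace_wqP_iff k h2 w).mp hw
          apply Subtype.ext
          funext j
          fin_cases j <;> simp [h1, h3, h04]
        right_inv := fun a => by
          funext j
          fin_cases j <;> simp }
    rw [E.finrank_eq, Module.finrank_fin_fun]
  have h := hironakaTau_add_finrank_invarianceSpace k
    ({X 0 ^ 2 + X 4 ^ 2 + X 1 * X 3} : Set (MvPolynomial (Fin 5) k))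
  omega

/-- **V-c separates the W2 pair**: `e_0 = 5 − τ(x̄²) = 4 ≠ 2 = 5 − τ(x̄² + v̄² + ȳw̄) = e_P` in
characteristic `2`, the origin in the larger-`e` class. [cite: CossartJannsenSaito2020, Def. 2.18,
Thm. 3.10] -/
theorem e_separates_W2 (h2 : (2 : k) = 0) :
    5 - hironakaTau k ({X 0 ^ 2} : Set (MvPolynomial (Fin 5) k)) = 4 ∧
      5 - hironakaTau k ({X 0 ^ 2 + X 4 ^ 2 + X 1 * X 3} : Set (MvPolynomial (Fin 5) k)) = 2 ∧
      5 - hironakaTau k ({X 0 ^ 2 + X 4 ^ 2 + X 1 * X 3} : Set (MvPolynomial (Fin 5) k)) <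
        5 - hironakaTau k ({X 0 ^ 2} : Set (MvPolynomial (Fin 5) k)) := by
  rw [hironakaTau_xSq k, hironakaTau_wqP k h2]
  norm_num

/-! ## The Hilbert–Samuel half: equal multiplicity ⇒ equal `H_X` (Bennett), over `Scheme.hsFun` -/

open AlgebraicGeometry IsLocalRing
open Literature.RingTheory.HilbertSamuel
open Summit.ResolutionOfSingularities.ResolutionOfSingularities.Theorems.SigmaMaxModificationsCorridor3

/-- **Hypersurface points of the same multiplicity have the same Hilbert–Samuel function** (CJS
Def. 2.28, any level `N` dominating both ambient dimensions): if `𝒪_{Y,y} ≅ R/(g)` and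
`𝒪_{Y',y'} ≅ R'/(g')` with `R, R'` regular local of dimensions `e, e' ≤ N + 1` and `g, g'` of order
EXACTLY `m ≥ 1`, then `H^N_Y(y) = H^N_{Y'}(y') (= hypersurfaceHFe (N+1) m)`. This is why the
Hilbert–Samuel function alone does not separate the K3.2 pairs (both points of each pair have
multiplicity `2`), read over the tree's `Scheme.hsFun`. [cite: CossartJannsenSaito2020, Def. 2.28, Thm. 2.3] -/
theorem hsFun_eq_of_hypersurface_presentations {Y Y' : Scheme.{u}} {y : Y} {y' : Y'} {N m : ℕ}
    {R : Type v} [CommRing R] [IsRegularLocalRing R] {R' : Type v} [CommRing R']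
    [IsRegularLocalRing R'] {e e' : ℕ} (he : ringKrullDim R = e) (he' : ringKrullDim R' = e')
    (heN : e ≤ N + 1) (heN' : e' ≤ N + 1) (hm : 1 ≤ m) {g : R} {g' : R'}
    (hg : g ∈ maximalIdeal R ^ m) (hg₁ : g ∉ maximalIdeal R ^ (m + 1))
    (hg' : g' ∈ maximalIdeal R' ^ m) (hg'₁ : g' ∉ maximalIdeal R' ^ (m + 1))
    (ε : Y.presheaf.stalk y ≃+* R ⧸ Ideal.span {g})
    (ε' : Y'.presheaf.stalk y' ≃+* R' ⧸ Ideal.span {g'}) :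
    Scheme.hsFun Y N y = Scheme.hsFun Y' N y' := by
  rw [Helpers.hsFun_eq_hypersurfaceHFe_of_stalk_ringEquiv he heN hm hg hg₁ ε,
    Helpers.hsFun_eq_hypersurfaceHFe_of_stalk_ringEquiv he' heN' hm hg' hg'₁ ε']

end Summit.ResolutionOfSingularities.ResolutionOfSingularities.Theorems.CampaignW32.K32Prime

end
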